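import Literature.NumberTheory.Transcendental.KZBallPeeling
import Literature.NumberTheory.Transcendental.KZBallPeelingAux
import Literature.NumberTheory.Transcendental.KZGaussMultiplicationChain
import Literature.NumberTheory.Transcendental.KZSubcalculusInvariants
import HarnessLib

/-!
# Even-dimensional balls inside the Kontsevich–Zagier rules: `k!·⟦B_{2k}⟧ = ⟦β(½,½)⟧^k`

Generic, fully proved lemmas of the Kontsevich–Zagier calculus (Kontsevich–Zagier 2001, §1.1–1.2,
§4.1) in the formal period ring `P = KZ.FormalPeriodRing` (`KZRulesAssociator.lean`), for
representations PINNED by domain and integrand; below `β(a,b)` is a representation pinned as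
`[(0,1), t^{a−1}(1−t)^{b−1}]`, `B_n` the open unit ball, `[pt, q] = IntegralRep.unit.constMul q`.

* constants (complementing `KZ.toFormalPeriod_of_constMul` of `KZGaussMultiplicationChain.lean`,
  `⟦[σ, q f]⟧ = ⟦[pt, q]⟧·⟦[σ, f]⟧`): `KZ.toFormalPeriod_of_unit_constMul_natCast` (`⟦[pt, k]⟧ = k`),
  `KZ.natCast_add_one_mul_toFormalPeriod_of_unit_constMul_inv` (`(m+1)·⟦[pt, 1/(m+1)]⟧ = 1`);
* `KZ.BallPeeling.betaOne_equivalent_unit_constMul` — `β(1, m+1) ∼ [pt, 1/(m+1)]`: ONE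
  Newton–Leibniz move over the point (primitive `−(1−t)^{m+1}/(m+1)`) and the null boundary;
* `KZ.BallPeeling.natCast_add_one_mul_toFormalPeriod_disc` — `(e+1)·⟦[disc, (1−|w|²)^e]⟧ = ⟦β(½,½)⟧`;
* `KZ.BallPeeling.prod_mul_toFormalPeriod_ball` — `(e+1)⋯(e+k)·⟦[B_{2k}, (1−|z|²)^e]⟧ = ⟦β(½,½)⟧^k`
  (induction on `k` along `peelTwo_equivalent`); at `e = 0`:
  `KZ.BallPeeling.factorial_mul_toFormalPeriod_ball` — `k!·⟦[B_{2k}, 1]⟧ = ⟦β(½,½)⟧^k`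
  (`vol B_{2k} = π^k/k!` inside the rules) and `KZ.BallPeeling.toFormalPeriod_ball_factorial` —
  `⟦[B_{2k}, k!]⟧ = ⟦β(½,½)⟧^k`.

The disc and ball statements take as an explicit HYPOTHESIS (`hdir`) Dirichlet's re-association
`⟦β(a,b)⟧·⟦β(a+b,c)⟧ = ⟦β(b,c)⟧·⟦β(a,b+c)⟧` of pinned Beta classes in `P` (Andrews–Askey–Roy 1999,
Thm 1.8.1), used only at `(a,b,c) = (½,½,e+1)`; the other inputs are the peeling charts of
`KZBallPeeling.lean` / `KZBallPeelingAux.lean` and Euler's Beta representations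
(`KZ.exists_betaRep'`). Everything is proved; no `def`, no named fact.
-/

noncomputable section

open MeasureTheory Set
open Literature.ModelTheory.ExponentialFields (IsSemialgebraic isSemialgebraic_univ
  isSemialgebraic_setOf_eval_le)
open MvPolynomial (aeval X C)

namespace Literature.NumberTheory.Transcendental

namespace KZ

/-! ## Constants in the formal period ring -/

/-- **`⟦[pt, k]⟧ = k`** for a natural number `k`: integer scaling is integrand additivity
(`KZ.IntegralRep.of_constMul_nat_sub_nsmul_mem_relations`) and `⟦[pt, 1]⟧ = 1`.
[cite: KontsevichZagier2001, §1.2 rule (1)] -/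
theorem toFormalPeriod_of_unit_constMul_natCast (k : ℕ) (hk : IsAlgebraic ℚ (k : ℝ)) :
    toFormalPeriod (of (IntegralRep.unit.constMul (k : ℝ) hk)) = (k : FormalPeriodRing) := by
  have h := toFormalPeriod_eq_iff.mpr
    (IntegralRep.of_constMul_nat_sub_nsmul_mem_relations IntegralRep.unit k)
  rw [map_nsmul, toFormalPeriod_of_unit, nsmul_one] at h
  exact h

/-- **`(m + 1) · ⟦[pt, 1/(m+1)]⟧ = 1`**: the point representations multiply
(`[pt, a] × [pt, b]` and `[pt, ab]` have the same domain `ℝ⁰` and integrand), `⟦[pt, m+1]⟧ = m + 1`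
and `[pt, (m+1)·(m+1)⁻¹] = [pt, 1]`. [cite: KontsevichZagier2001, §4.1] -/
theorem natCast_add_one_mul_toFormalPeriod_of_unit_constMul_inv (m : ℕ)
    (h : IsAlgebraic ℚ (((m : ℝ) + 1)⁻¹)) :
    ((m : FormalPeriodRing) + 1) *
      toFormalPeriod (of (IntegralRep.unit.constMul (((m : ℝ) + 1)⁻¹) h)) = 1 := by
  have hm : IsAlgebraic ℚ ((m : ℝ) + 1) := by exact_mod_cast isAlgebraic_nat (m + 1)
  have h1 : toFormalPeriod (of (IntegralRep.unit.constMul ((m : ℝ) + 1) hm)) =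
      (m : FormalPeriodRing) + 1 := by
    exact_mod_cast toFormalPeriod_of_unit_constMul_natCast (m + 1) (isAlgebraic_nat (m + 1))
  have h2 : toFormalPeriod (of (IntegralRep.unit.constMul ((m : ℝ) + 1) hm)) *
      toFormalPeriod (of (IntegralRep.unit.constMul (((m : ℝ) + 1)⁻¹) h)) =
        toFormalPeriod (of IntegralRep.unit) := by
    rw [toFormalPeriod_of_mul_of]
    apply toFormalPeriod_eq_iff.mpr
    refine of_sub_of_mem_relations_of_eqOn ?_ fun z _ => ?_
    · ext z
      simp [IntegralRep.prodDomain]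
    · rw [IntegralRep.prod_integrand_eq]
      have h0 : (m : ℝ) + 1 ≠ 0 := by positivity
      simp [IntegralRep.prodFun, h0]
  rw [← h1, h2, toFormalPeriod_of_unit]

namespace BallPeeling

/-! ## `β(1, m+1) ∼ [pt, 1/(m+1)]` by one Newton–Leibniz move -/

/-- **`β(1, m+1) = [(0,1), (1 − t)^m] ∼ [pt, 1/(m+1)]`** for a representation pinned as the Beta
representation `β(1, m+1)`: ONE Newton–Leibniz move over the point (rule 3, primitive
`F(t) = −(1−t)^{m+1}/(m+1)` on the closed slab `[0,1]`, `F(1) − F(0) = 1/(m+1)`), the null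
boundary `{0, 1}` (rule 1a) and agreement of the integrands on `(0,1)` (rule 1b). Value identity
`B(1, m+1) = 1/(m+1)`. [cite: KontsevichZagier2001, §1.2 rule (3)] -/
theorem betaOne_equivalent_unit_constMul (m : ℕ) (β : IntegralRep 1)
    (hβd : β.domain = {t | t 0 ∈ Set.Ioo (0:ℝ) 1})
    (hβi : Set.EqOn β.integrand
      (fun t => (t 0) ^ (((1:ℚ):ℝ) - 1) * (1 - t 0) ^ ((((m:ℚ) + 1 : ℚ):ℝ) - 1)) β.domain)
    (h : IsAlgebraic ℚ (((m : ℝ) + 1)⁻¹)) :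
    Equivalent β (IntegralRep.unit.constMul (((m : ℝ) + 1)⁻¹) h) := by
  -- the closed slab `R = [[0,1], (1 - t)^m]`
  have hIcc : IsSemialgebraic ℚ {x : Fin 1 → ℝ | x 0 ∈ Set.Icc (0:ℝ) 1} := by
    have h1 := isSemialgebraic_setOf_eval_le (k := ℚ) (R := ℝ) (0 : MvPolynomial (Fin 1) ℚ) (X 0)
    have h2 := isSemialgebraic_setOf_eval_le (k := ℚ) (R := ℝ) (X 0 : MvPolynomial (Fin 1) ℚ) 1
    rw [show {x : Fin 1 → ℝ | x 0 ∈ Set.Icc (0:ℝ) 1} = {x : Fin 1 → ℝ | 0 ≤ x 0} ∩ {x | x 0 ≤ 1} by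
      ext x; simp]
    simpa using h1.inter h2
  obtain ⟨R, hRd, hRi⟩ : ∃ R : IntegralRep 1, R.domain = {x | x 0 ∈ Set.Icc (0:ℝ) 1} ∧
      R.integrand = fun x => (1 - x 0) ^ m := by
    refine ⟨⟨_, _, hIcc, ?_, ?_⟩, rfl, rfl⟩
    · exact (isSemialgebraicFunOn_aeval hIcc ((1 - X 0) ^ m)).congr fun x _ => by simp
    · have hK : IsCompact (Set.pi univ fun _ : Fin 1 => Set.Icc (0:ℝ) 1) :=
        isCompact_univ_pi fun _ => isCompact_Icc
      refine ((by fun_prop : Continuous fun x : Fin 1 → ℝ => (1 - x 0) ^ m).continuousOn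
        |>.integrableOn_compact hK).mono_set fun x hx => ?_
      have hx' : 0 ≤ x 0 ∧ x 0 ≤ 1 := hx
      simp only [mem_univ_pi, Fin.forall_fin_one, mem_Icc]
      exact hx'
  -- (1) Newton–Leibniz over the point: `[R] − [pt, 1/(m+1)]`
  have h1 : of R - of (IntegralRep.unit.constMul (((m : ℝ) + 1)⁻¹) h) ∈ relations := by
    refine newtonLeibnizRel_subset_relations ⟨0, R, _, fun _ => (0:ℝ), fun _ => (1:ℝ),
      fun z => -(1 - z (Fin.last 0)) ^ (m + 1) * ((m : ℝ) + 1)⁻¹, ?_, ?_, ?_,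
      fun _ _ => zero_le_one, ?_, ?_, ?_, ?_, rfl⟩
    · rw [hRd]
      refine (isSemialgebraicFunOn_aeval hIcc
        (-(1 - X (Fin.last 0)) ^ (m + 1) * C (((m : ℚ) + 1)⁻¹))).congr fun z _ => ?_
      simp
    · exact (isSemialgebraicFunOn_aeval isSemialgebraic_univ (0 : MvPolynomial (Fin 0) ℚ)).congr
        fun x _ => by simp
    · exact (isSemialgebraicFunOn_aeval isSemialgebraic_univ (1 : MvPolynomial (Fin 0) ℚ)).congr
        fun x _ => by simp
    · rw [hRd]
      ext z
      simp only [mem_setOf_eq, mem_Icc, IntegralRep.domain_constMul, IntegralRep.unit_domain,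
        mem_univ, true_and]
      rfl
    · intro x _
      simp only [Fin.snoc_last]
      exact (by fun_prop : Continuous fun t : ℝ => -(1 - t) ^ (m + 1) * ((m : ℝ) + 1)⁻¹).continuousOn
    · intro x _ t _
      simp only [Fin.snoc_last, hRi]
      rw [show (0 : Fin 1) = Fin.last 0 from rfl, Fin.snoc_last]
      have h0 : (m : ℝ) + 1 ≠ 0 := by positivity
      refine ((((hasDerivAt_id' t).const_sub 1).pow (m + 1)).neg.mul_const
        (((m : ℝ) + 1)⁻¹)).congr_deriv ?_
      rw [Nat.add_sub_cancel]
      push_cast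
      field_simp
    · intro x _
      have e : ∀ s : ℝ, (Fin.snoc x s : Fin 1 → ℝ) 0 = s := fun s => by
        rw [show (0 : Fin 1) = Fin.last 0 from rfl, Fin.snoc_last]
      simp [IntegralRep.integrand_constMul, e]
  -- (2) the null boundary `{0, 1}`
  have hsub : {x : Fin 1 → ℝ | x 0 ∈ Set.Ioo (0:ℝ) 1} ⊆ R.domain := by
    rw [hRd]
    exact fun x hx => Ioo_subset_Icc_self hx
  have h2 : of R - of (R.restrict _ isSemialgebraic_posIoo hsub) ∈ relations := by
    refine R.of_sub_of_restrict_mem_relations isSemialgebraic_posIoo hsub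
      (measure_mono_null (fun x hx => ?_) (measure_union_null (volume_setOf_apply_eq_const 1 0 0)
        (volume_setOf_apply_eq_const 1 0 1)))
    rw [hRd] at hx
    obtain ⟨⟨h0, h1⟩, h3⟩ := hx
    simp only [mem_setOf_eq, mem_Ioo, not_and, not_lt] at h3
    simp only [mem_union, mem_setOf_eq]
    rcases h0.lt_or_eq with h0 | h0
    · exact Or.inr (le_antisymm h1 (h3 h0))
    · exact Or.inl h0.symm
  -- (3) same domain, same integrand on it
  have h3 : of β - of (R.restrict _ isSemialgebraic_posIoo hsub) ∈ relations := by
    refine of_sub_of_mem_relations_of_eqOn (by rw [IntegralRep.domain_restrict, hβd])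
      fun x hx => ?_
    rw [hβi hx, IntegralRep.integrand_restrict, hRi]
    dsimp only
    rw [show (((m:ℚ) + 1 : ℚ):ℝ) - 1 = ((m : ℕ) : ℝ) by push_cast; ring, Real.rpow_natCast]
    norm_num
  have : of β - of (IntegralRep.unit.constMul (((m : ℝ) + 1)⁻¹) h) =
      (of β - of (R.restrict _ isSemialgebraic_posIoo hsub)) -
        (of R - of (R.restrict _ isSemialgebraic_posIoo hsub)) +
        (of R - of (IntegralRep.unit.constMul (((m : ℝ) + 1)⁻¹) h)) := by abel
  rw [Equivalent, this]
  exact relations.add_mem (relations.sub_mem h3 h2) h1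

/-! ## The disc factor: `(e+1)·⟦[disc, (1−|w|²)^e]⟧ = ⟦β(½,½)⟧` -/

/-- **The disc factor.** For representations pinned as `D = [disc, (1 − |w|²)^e]` (`e ∈ ℕ`) and
`H = β(½,½) = [(0,1), t^{−1/2}(1−t)^{−1/2}]`, and GIVEN Dirichlet's re-association
`β(a,b)β(a+b,c) = β(b,c)β(a,b+c)` of pinned Beta classes in the formal period ring (hypothesis
`hdir`), `(e + 1)·⟦D⟧ = ⟦H⟧`. Chain: `D ∼ [(−1,1),(1−x²)^{e+1/2}] × [(−1,1),(1−s²)^e]`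
(`discToSquare_equivalent`) `∼ β(½, e+3/2) × β(½, e+1)` (the symmetric Beta folds), Dirichlet at
`(a,b,c) = (½,½,e+1)`: `⟦H⟧·⟦β(1,e+1)⟧ = ⟦β(½,e+1)⟧·⟦β(½,e+3/2)⟧`, and
`β(1,e+1) ∼ [pt, 1/(e+1)]` (`betaOne_equivalent_unit_constMul`). Value identity
`(e+1) ∫_disc (1−|w|²)^e dw = π = B(½,½)`; `e = 0` is the area of the unit disc.
[cite: KontsevichZagier2001, §1.1] -/
theorem natCast_add_one_mul_toFormalPeriod_disc (e : ℕ) (D : IntegralRep 2) (H : IntegralRep 1)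
    (hDd : D.domain = {w | ∑ i, (w i) ^ 2 < 1})
    (hDi : Set.EqOn D.integrand (fun w => (1 - ∑ i, (w i) ^ 2) ^ e) D.domain)
    (hHd : H.domain = {t | t 0 ∈ Set.Ioo (0:ℝ) 1})
    (hHi : Set.EqOn H.integrand
      (fun t => (t 0) ^ (((1 / 2 : ℚ) : ℝ) - 1) * (1 - t 0) ^ (((1 / 2 : ℚ) : ℝ) - 1)) H.domain)
    (hdir : ∀ (a b c : ℚ), 0 < a → 0 < b → 0 < c → ∀ (β₁ β₂ β₃ β₄ : IntegralRep 1),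
      β₁.domain = {t | t 0 ∈ Set.Ioo (0:ℝ) 1} →
      Set.EqOn β₁.integrand (fun t => (t 0) ^ ((a : ℝ) - 1) * (1 - t 0) ^ ((b : ℝ) - 1)) β₁.domain →
      β₂.domain = {t | t 0 ∈ Set.Ioo (0:ℝ) 1} → Set.EqOn β₂.integrand
        (fun t => (t 0) ^ (((a + b : ℚ) : ℝ) - 1) * (1 - t 0) ^ ((c : ℝ) - 1)) β₂.domain →
      β₃.domain = {t | t 0 ∈ Set.Ioo (0:ℝ) 1} →
      Set.EqOn β₃.integrand (fun t => (t 0) ^ ((b : ℝ) - 1) * (1 - t 0) ^ ((c : ℝ) - 1)) β₃.domain →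
      β₄.domain = {t | t 0 ∈ Set.Ioo (0:ℝ) 1} → Set.EqOn β₄.integrand
        (fun t => (t 0) ^ ((a : ℝ) - 1) * (1 - t 0) ^ (((b + c : ℚ) : ℝ) - 1)) β₄.domain →
      toFormalPeriod (of β₁) * toFormalPeriod (of β₂) = toFormalPeriod (of β₃) * toFormalPeriod (of β₄)) :
    ((e : FormalPeriodRing) + 1) * toFormalPeriod (of D) = toFormalPeriod (of H) := by
  have hh : (0 : ℚ) < 1 / 2 := by norm_num
  have he1 : (0 : ℚ) < (e : ℚ) + 1 := by positivity
  have he3 : (0 : ℚ) < (e : ℚ) + 3 / 2 := by positivity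
  -- the four auxiliary representations
  obtain ⟨A₁, hA₁d, hA₁i⟩ := exists_symIntervalRep_nat_add_half e
  obtain ⟨A₂, hA₂d, hA₂i⟩ := exists_symIntervalRep_nat e
  obtain ⟨β₃, hβ₃d, hβ₃i⟩ := exists_betaRep' (1 / 2) ((e : ℚ) + 3 / 2) hh he3
  obtain ⟨β₄, hβ₄d, hβ₄i⟩ := exists_betaRep' (1 / 2) ((e : ℚ) + 1) hh he1
  obtain ⟨β₂, hβ₂d, hβ₂i⟩ := exists_betaRep' 1 ((e : ℚ) + 1) one_pos he1
  -- `D ∼ A₁ × A₂ ∼ β₃ × β₄`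
  have hD : Equivalent D (β₃.prod β₄) :=
    (discToSquare_equivalent e D A₁ A₂ hDd hDi hA₁d (fun x _ => by rw [hA₁i]) hA₂d
      (fun x _ => by rw [hA₂i])).trans (Equivalent.prod
      (symmetricBeta_equivalent_nat_add_half e A₁ β₃ hA₁d (fun x _ => by rw [hA₁i]) hβ₃d
        (fun x _ => by rw [hβ₃i]))
      (symmetricBeta_equivalent_nat e A₂ β₄ hA₂d (fun x _ => by rw [hA₂i]) hβ₄d
        (fun x _ => by rw [hβ₄i])))
  -- Dirichlet at `(½, ½, e+1)`: `⟦H⟧ ⟦β₂⟧ = ⟦β₄⟧ ⟦β₃⟧`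
  have hdir' : toFormalPeriod (of H) * toFormalPeriod (of β₂) =
      toFormalPeriod (of β₄) * toFormalPeriod (of β₃) := by
    refine hdir (1 / 2) (1 / 2) ((e : ℚ) + 1) hh hh he1 H β₂ β₄ β₃ hHd hHi hβ₂d (fun t _ => ?_)
      hβ₄d (fun t _ => by rw [hβ₄i]) hβ₃d (fun t _ => ?_)
    · rw [hβ₂i]
      norm_num
    · rw [hβ₃i]
      dsimp only
      congr 2
      push_cast
      ring
  -- `β₂ ∼ [pt, 1/(e+1)]`
  have hq : IsAlgebraic ℚ (((e : ℝ) + 1)⁻¹) := by exact_mod_cast (isAlgebraic_nat (e + 1)).inv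
  have hβ₂ : toFormalPeriod (of β₂) =
      toFormalPeriod (of (IntegralRep.unit.constMul (((e : ℝ) + 1)⁻¹) hq)) :=
    (betaOne_equivalent_unit_constMul e β₂ hβ₂d (fun t _ => by rw [hβ₂i]) hq).toFormalPeriod_eq
  calc ((e : FormalPeriodRing) + 1) * toFormalPeriod (of D)
      = ((e : FormalPeriodRing) + 1) * (toFormalPeriod (of β₄) * toFormalPeriod (of β₃)) := by
        rw [hD.toFormalPeriod_eq, ← toFormalPeriod_of_mul_of, mul_comm (toFormalPeriod (of β₃))]
    _ = toFormalPeriod (of H) * (((e : FormalPeriodRing) + 1) *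
          toFormalPeriod (of (IntegralRep.unit.constMul (((e : ℝ) + 1)⁻¹) hq))) := by
        rw [← hdir', hβ₂]
        ring
    _ = toFormalPeriod (of H) := by
        rw [natCast_add_one_mul_toFormalPeriod_of_unit_constMul_inv, mul_one]

/-! ## The ball: `(e+1)(e+2)⋯(e+k)·⟦[B_{2k}, (1−|z|²)^e]⟧ = ⟦β(½,½)⟧^k` -/

/-- **Even-dimensional balls with a polynomial weight.** For representations pinned as
`B = [B_{2k}, (1 − |z|²)^e]` and `H = β(½,½)`, given Dirichlet's re-association of pinned Beta
classes (hypothesis `hdir`): `(∏_{i<k} (e + i + 1)) · ⟦B⟧ = ⟦H⟧^k` in the formal period ring.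
Induction on `k`: `[B_0, 1] = [pt, 1]` is the unit; `[B_{2k+2}, (1−|z|²)^e] ∼
[B_{2k}, (1−|z'|²)^{e+1}] × [disc, (1−|w|²)^e]` (`peelTwo_equivalent`, one change of variables)
and `(e+1)·⟦disc factor⟧ = ⟦H⟧` (`natCast_add_one_mul_toFormalPeriod_disc`). Value identity
`∫_{B_{2k}} (1−|z|²)^e dz = π^k e!/(e+k)!`. [cite: KontsevichZagier2001, §1.2 rule (2)] -/
theorem prod_mul_toFormalPeriod_ball (k : ℕ) : ∀ (e : ℕ) (B : IntegralRep (2 * k)) (H : IntegralRep 1),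
    B.domain = {z | ∑ i, (z i) ^ 2 < 1} →
    Set.EqOn B.integrand (fun z => (1 - ∑ i, (z i) ^ 2) ^ e) B.domain →
    H.domain = {t | t 0 ∈ Set.Ioo (0:ℝ) 1} →
    Set.EqOn H.integrand
      (fun t => (t 0) ^ (((1 / 2 : ℚ) : ℝ) - 1) * (1 - t 0) ^ (((1 / 2 : ℚ) : ℝ) - 1)) H.domain →
    (∀ (a b c : ℚ), 0 < a → 0 < b → 0 < c → ∀ (β₁ β₂ β₃ β₄ : IntegralRep 1),
      β₁.domain = {t | t 0 ∈ Set.Ioo (0:ℝ) 1} →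
      Set.EqOn β₁.integrand (fun t => (t 0) ^ ((a : ℝ) - 1) * (1 - t 0) ^ ((b : ℝ) - 1)) β₁.domain →
      β₂.domain = {t | t 0 ∈ Set.Ioo (0:ℝ) 1} → Set.EqOn β₂.integrand
        (fun t => (t 0) ^ (((a + b : ℚ) : ℝ) - 1) * (1 - t 0) ^ ((c : ℝ) - 1)) β₂.domain →
      β₃.domain = {t | t 0 ∈ Set.Ioo (0:ℝ) 1} →
      Set.EqOn β₃.integrand (fun t => (t 0) ^ ((b : ℝ) - 1) * (1 - t 0) ^ ((c : ℝ) - 1)) β₃.domain →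
      β₄.domain = {t | t 0 ∈ Set.Ioo (0:ℝ) 1} → Set.EqOn β₄.integrand
        (fun t => (t 0) ^ ((a : ℝ) - 1) * (1 - t 0) ^ (((b + c : ℚ) : ℝ) - 1)) β₄.domain →
      toFormalPeriod (of β₁) * toFormalPeriod (of β₂) = toFormalPeriod (of β₃) * toFormalPeriod (of β₄)) →
    (∏ i ∈ Finset.range k, ((e : FormalPeriodRing) + i + 1)) * toFormalPeriod (of B) =
      toFormalPeriod (of H) ^ k := by
  induction k with
  | zero =>
    intro e B H hBd hBi hHd hHi hdir
    have hB : Equivalent B IntegralRep.unit := by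
      refine of_sub_of_mem_relations_of_eqOn ?_ fun z hz => ?_
      · rw [IntegralRep.unit_domain, hBd]
        ext z
        simp
      · rw [hBi hz, IntegralRep.unit_integrand]
        simp
    rw [Finset.prod_range_zero, one_mul, pow_zero, hB.toFormalPeriod_eq, toFormalPeriod_of_unit]
  | succ k ih =>
    intro e B H hBd hBi hHd hHi hdir
    obtain ⟨B', hB'd, hB'i⟩ := exists_ballRep (2 * k) (e + 1)
    obtain ⟨Q, hQd, hQi⟩ := exists_ballRep 2 e
    have hB : Equivalent B (B'.prod Q) :=
      peelTwo_equivalent k e B B' Q hBd hBi hB'd (fun z _ => by rw [hB'i]) hQd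
        (fun w _ => by rw [hQi])
    have ih' := ih (e + 1) B' H hB'd (fun z _ => by rw [hB'i]) hHd hHi hdir
    have hQ := natCast_add_one_mul_toFormalPeriod_disc e Q H hQd (fun w _ => by rw [hQi]) hHd hHi
      hdir
    have hprod : ∏ i ∈ Finset.range k, ((e : FormalPeriodRing) + (i + 1 : ℕ) + 1) =
        ∏ i ∈ Finset.range k, ((((e + 1 : ℕ)) : FormalPeriodRing) + i + 1) :=
      Finset.prod_congr rfl fun i _ => by push_cast; ring
    rw [Finset.prod_range_succ', hprod, hB.toFormalPeriod_eq, ← toFormalPeriod_of_mul_of, pow_succ,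
      ← ih', ← hQ]
    push_cast
    ring

/-- **`k!·⟦B_{2k}⟧ = ⟦β(½,½)⟧^k`**: for representations pinned as `b = [B_{2k}, 1]` (the volume of
the unit ball of `ℝ^{2k}`) and `H = β(½,½)`, given Dirichlet's re-association of pinned Beta
classes (hypothesis `hdir`), `k! · ⟦b⟧ = ⟦H⟧^k` in the formal period ring
(`prod_mul_toFormalPeriod_ball` at `e = 0`). Value identity `k! · vol B_{2k} = π^k`.
[cite: KontsevichZagier2001, §1.1] -/
theorem factorial_mul_toFormalPeriod_ball (k : ℕ) (b : IntegralRep (2 * k)) (H : IntegralRep 1)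
    (hbd : b.domain = {z | ∑ i, (z i) ^ 2 < 1})
    (hbi : Set.EqOn b.integrand (fun _ => 1) b.domain)
    (hHd : H.domain = {t | t 0 ∈ Set.Ioo (0:ℝ) 1})
    (hHi : Set.EqOn H.integrand
      (fun t => (t 0) ^ (((1 / 2 : ℚ) : ℝ) - 1) * (1 - t 0) ^ (((1 / 2 : ℚ) : ℝ) - 1)) H.domain)
    (hdir : ∀ (a b c : ℚ), 0 < a → 0 < b → 0 < c → ∀ (β₁ β₂ β₃ β₄ : IntegralRep 1),
      β₁.domain = {t | t 0 ∈ Set.Ioo (0:ℝ) 1} →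
      Set.EqOn β₁.integrand (fun t => (t 0) ^ ((a : ℝ) - 1) * (1 - t 0) ^ ((b : ℝ) - 1)) β₁.domain →
      β₂.domain = {t | t 0 ∈ Set.Ioo (0:ℝ) 1} → Set.EqOn β₂.integrand
        (fun t => (t 0) ^ (((a + b : ℚ) : ℝ) - 1) * (1 - t 0) ^ ((c : ℝ) - 1)) β₂.domain →
      β₃.domain = {t | t 0 ∈ Set.Ioo (0:ℝ) 1} →
      Set.EqOn β₃.integrand (fun t => (t 0) ^ ((b : ℝ) - 1) * (1 - t 0) ^ ((c : ℝ) - 1)) β₃.domain →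
      β₄.domain = {t | t 0 ∈ Set.Ioo (0:ℝ) 1} → Set.EqOn β₄.integrand
        (fun t => (t 0) ^ ((a : ℝ) - 1) * (1 - t 0) ^ (((b + c : ℚ) : ℝ) - 1)) β₄.domain →
      toFormalPeriod (of β₁) * toFormalPeriod (of β₂) = toFormalPeriod (of β₃) * toFormalPeriod (of β₄)) :
    (k.factorial : FormalPeriodRing) * toFormalPeriod (of b) = toFormalPeriod (of H) ^ k := by
  have h := prod_mul_toFormalPeriod_ball k 0 b H hbd (fun z hz => by rw [hbi hz]; simp) hHd hHi
    hdir
  rw [← Finset.prod_range_add_one_eq_factorial, Nat.cast_prod]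
  simpa using h

/-- **`⟦[B_{2k}, k!]⟧ = ⟦β(½,½)⟧^k`**: the same identity with the factorial inside the
representation, `b = [B_{2k}, k!]` (`⟦[σ, k f]⟧ = ⟦[pt, k]⟧·⟦[σ, f]⟧ = k·⟦[σ, f]⟧`).
[cite: KontsevichZagier2001, §1.1] -/
theorem toFormalPeriod_ball_factorial (k : ℕ) (b : IntegralRep (2 * k)) (H : IntegralRep 1)
    (hbd : b.domain = {z | ∑ i, (z i) ^ 2 < 1})
    (hbi : Set.EqOn b.integrand (fun _ => (k.factorial : ℝ)) b.domain)
    (hHd : H.domain = {t | t 0 ∈ Set.Ioo (0:ℝ) 1})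
    (hHi : Set.EqOn H.integrand
      (fun t => (t 0) ^ (((1 / 2 : ℚ) : ℝ) - 1) * (1 - t 0) ^ (((1 / 2 : ℚ) : ℝ) - 1)) H.domain)
    (hdir : ∀ (a b c : ℚ), 0 < a → 0 < b → 0 < c → ∀ (β₁ β₂ β₃ β₄ : IntegralRep 1),
      β₁.domain = {t | t 0 ∈ Set.Ioo (0:ℝ) 1} →
      Set.EqOn β₁.integrand (fun t => (t 0) ^ ((a : ℝ) - 1) * (1 - t 0) ^ ((b : ℝ) - 1)) β₁.domain →
      β₂.domain = {t | t 0 ∈ Set.Ioo (0:ℝ) 1} → Set.EqOn β₂.integrand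
        (fun t => (t 0) ^ (((a + b : ℚ) : ℝ) - 1) * (1 - t 0) ^ ((c : ℝ) - 1)) β₂.domain →
      β₃.domain = {t | t 0 ∈ Set.Ioo (0:ℝ) 1} →
      Set.EqOn β₃.integrand (fun t => (t 0) ^ ((b : ℝ) - 1) * (1 - t 0) ^ ((c : ℝ) - 1)) β₃.domain →
      β₄.domain = {t | t 0 ∈ Set.Ioo (0:ℝ) 1} → Set.EqOn β₄.integrand
        (fun t => (t 0) ^ ((a : ℝ) - 1) * (1 - t 0) ^ (((b + c : ℚ) : ℝ) - 1)) β₄.domain →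
      toFormalPeriod (of β₁) * toFormalPeriod (of β₂) = toFormalPeriod (of β₃) * toFormalPeriod (of β₄)) :
    toFormalPeriod (of b) = toFormalPeriod (of H) ^ k := by
  obtain ⟨b₁, hb₁d, hb₁i⟩ := exists_ballRep (2 * k) 0
  have hb : Equivalent b (b₁.constMul (k.factorial : ℝ) (isAlgebraic_nat _)) := by
    refine of_sub_of_mem_relations_of_eqOn (by rw [IntegralRep.domain_constMul, hb₁d, hbd])
      fun z hz => ?_
    rw [hbi hz, IntegralRep.integrand_constMul, hb₁i]
    simp
  rw [hb.toFormalPeriod_eq, toFormalPeriod_of_constMul, toFormalPeriod_of_unit_constMul_natCast]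
  exact factorial_mul_toFormalPeriod_ball k b₁ H hb₁d (fun z _ => by rw [hb₁i]; simp) hHd hHi
    hdir

end BallPeeling

end KZ

end Literature.NumberTheory.Transcendental
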